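import Mathlib
import Summits.ValiantsHypothesis.ValiantsHypothesis.Theorems.GeneratorObstructionsPowGenDegreeQPGadgetTableauTypes

/-!
# Route GeneratorObstructions — crux K2 `PowGenDegreeQP` (stmt-ValiantsHypothesis-11655), line
# `trace-side-regimes`: rows of the gadget tableau by block, and valid rearrangements respect blocks

Companion of `…GadgetTableauDefs/Frame/Types`.  The row `r` of a column is position `3c-1-r`; its
letter belongs to block `blockOfRow c r` with kind `kindOfRow c r` (`0 = A'`, `1 = A`, `2 = B`), the
inverse of `letterRow` (`blockOfRow_letterRow`, `kindOfRow_letterRow`, `letterRow_blockOfRow_kindOfRow`).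
Every box of label `u` sits on a row of block `labBlock u` (`blockOfRow_box`), and — the input of the
factorisation half of `gadgetTab_count` — **if every label receives the gadget monomial of its own
block (type preservation, `gadgetTab_block_eq`), then every column permutation preserves the block of
every row** (`blockOfRow_perm_eq`), so the signed count runs over block-respecting tuples only
(`…PermFibersPi`).

Honest framing: combinatorics of one explicit tableau; no stub, crux or summit is settled here;
`VP ≠ VNP` untouched. [folklore]
-/

namespace Summit.ValiantsHypothesis.ValiantsHypothesis.Theorems.GeneratorObstructions.PowGenDegreeQP

open Literature.Computability.AlgebraicComplexity Literature.Computability.AlgebraicComplexity.TableauEval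

-- `Summit.ValiantsHypothesis.ValiantsHypothesis.…` is the tree's mandated single-conjunct layout.
set_option linter.dupNamespace false

noncomputable section

/-! ## §1 Block and kind of a row -/

/-- The block of the letter on row `r` (position `p = 3c-1-r`): `A'_{c-1}` at `p = 3c-1`; otherwise
`p ≡ 1`: `A_{p/3}`, `p ≡ 2`: `B_{(p+1)/3}`, `p ≡ 0`: `B_0` (`p = 0`) or `A'_{p/3-1}`. [folklore] -/
def blockOfRow (c r : ℕ) : ℕ :=
  if 3 * c - 1 - r = 3 * c - 1 then c - 1
  else if (3 * c - 1 - r) % 3 = 1 then (3 * c - 1 - r) / 3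
  else if (3 * c - 1 - r) % 3 = 2 then (3 * c - 1 - r + 1) / 3
  else if 3 * c - 1 - r = 0 then 0 else (3 * c - 1 - r) / 3 - 1

/-- The kind (`0 = A'`, `1 = A`, `2 = B`) of the letter on row `r`. [folklore] -/
def kindOfRow (c r : ℕ) : Fin 3 :=
  if 3 * c - 1 - r = 3 * c - 1 then 0
  else if (3 * c - 1 - r) % 3 = 1 then 1
  else if (3 * c - 1 - r) % 3 = 2 then 2
  else if 3 * c - 1 - r = 0 then 2 else 0

/-- The three kinds. [folklore] -/
theorem fin3_cases (κ : Fin 3) : κ = 0 ∨ κ = 1 ∨ κ = 2 := by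
  fin_cases κ <;> simp

/-- `blockOfRow` inverts `letterRow`. [folklore] -/
theorem blockOfRow_letterRow {c j : ℕ} (hj : j < c) (κ : Fin 3) :
    blockOfRow c (letterRow c j κ) = j := by
  have hP := letterPos_le hj κ
  have e : 3 * c - 1 - letterRow c j κ = letterPos c j κ := by unfold letterRow; omega
  unfold blockOfRow
  rw [e]
  rcases fin3_cases κ with rfl | rfl | rfl
  · by_cases hjc : j = c - 1
    · rw [letterPos_zero, if_pos hjc, if_pos rfl]; omega
    · rw [letterPos_zero, if_neg hjc, if_neg (by omega), if_neg (by omega), if_neg (by omega),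
        if_neg (by omega)]
      omega
  · rw [letterPos_one, if_neg (by omega), if_pos (by omega)]
    omega
  · by_cases hj0 : j = 0
    · rw [letterPos_two, if_pos hj0, if_neg (by omega), if_neg (by omega), if_neg (by omega),
        if_pos rfl]
      omega
    · rw [letterPos_two, if_neg hj0, if_neg (by omega), if_neg (by omega), if_pos (by omega)]
      omega

/-- `kindOfRow` inverts `letterRow`. [folklore] -/
theorem kindOfRow_letterRow {c j : ℕ} (hj : j < c) (κ : Fin 3) :
    kindOfRow c (letterRow c j κ) = κ := by
  have hP := letterPos_le hj κ
  have e : 3 * c - 1 - letterRow c j κ = letterPos c j κ := by unfold letterRow; omega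
  unfold kindOfRow
  rw [e]
  rcases fin3_cases κ with rfl | rfl | rfl
  · by_cases hjc : j = c - 1
    · rw [letterPos_zero, if_pos hjc, if_pos rfl]
    · rw [letterPos_zero, if_neg hjc, if_neg (by omega), if_neg (by omega), if_neg (by omega),
        if_neg (by omega)]
  · rw [letterPos_one, if_neg (by omega), if_pos (by omega)]
  · by_cases hj0 : j = 0
    · rw [letterPos_two, if_pos hj0, if_neg (by omega), if_neg (by omega), if_neg (by omega),
        if_pos rfl]
    · rw [letterPos_two, if_neg hj0, if_neg (by omega), if_neg (by omega), if_pos (by omega)]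

/-- `letterRow` inverts `(blockOfRow, kindOfRow)` on rows `< 3c`, and the block is `< c`. [folklore] -/
theorem letterRow_blockOfRow_kindOfRow {c r : ℕ} (hc : 1 ≤ c) (hr : r < 3 * c) :
    blockOfRow c r < c ∧ letterRow c (blockOfRow c r) (kindOfRow c r) = r := by
  unfold blockOfRow kindOfRow letterRow letterPos
  split_ifs <;> simp_all <;> omega

/-! ## §2 Boxes sit on rows of their own block -/

/-- The row of the `s`-th box of label `u` is a block-`labBlock u` row. [folklore] -/
theorem exists_kind_boxRow (k c : ℕ) (u s : ℕ) :
    ∃ κ : Fin 3, (boxColRow k c u s).2 = letterRow c (labBlock u) κ := by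
  unfold boxColRow
  split_ifs
  · exact ⟨_, rfl⟩
  · exact ⟨_, rfl⟩

/-- Every box of label `u` sits on a row of block `labBlock u`. [folklore] -/
theorem blockOfRow_box (k c : ℕ) {u : ℕ} (hu : labBlock u < c) (s : ℕ) :
    blockOfRow c (boxColRow k c u s).2 = labBlock u := by
  obtain ⟨κ, hκ⟩ := exists_kind_boxRow k c u s
  rw [hκ, blockOfRow_letterRow hu]

/-! ## §3 Valid rearrangements respect blocks -/

variable {σ : Type*} [LinearOrder σ]

/-- **Type-respecting labels force block-respecting columns**: if every label receives the gadget
monomial of its own block under `π`, then every column permutation maps each row to a row of the same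
block. [folklore] -/
theorem blockOfRow_perm_eq (k c : ℕ) (hk : 1 ≤ k) (hc : 1 ≤ c) {x : ℕ → σ} {N : ℕ}
    (hx : IsAntitoneEnum x N) (hN : 3 * c ≤ N) (π : (gadgetTab k c hk hc x).Bij)
    (hV : ∀ u : Fin (gadgetTab k c hk hc x).d, (gadgetTab k c hk hc x).content π u =
      gadgetExp k (fun i : Fin c => x (letterRow c i 2)) (fun i => x (letterRow c i 1))
        (fun i => x (letterRow c i 0)) ⟨labBlock u, (labBlock_lt u).1⟩)
    (n : Fin (gadgetTab k c hk hc x).C) (r : Fin ((gadgetTab k c hk hc x).h n)) :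
    blockOfRow c (π n r).val = blockOfRow c r.val := by
  classical
  obtain ⟨⟨u, s⟩, hus⟩ := (gadgetTabFrame k c hk hc x).boxEquiv.surjective ⟨n, r⟩
  have hbox : (gadgetTab k c hk hc x).box u s = ⟨n, r⟩ := by
    rw [(gadgetTabFrame k c hk hc x).box_eq]; exact hus
  suffices H : ∀ b : (m : Fin (gadgetTab k c hk hc x).C) × Fin ((gadgetTab k c hk hc x).h m),
      (gadgetTab k c hk hc x).box u s = b → blockOfRow c (π b.1 b.2).val = blockOfRow c b.2.val from
    H _ hbox
  intro b hb
  subst hb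
  -- the box `(u, s)` sits on a block-`labBlock u` row …
  have hrow : blockOfRow c ((gadgetTab k c hk hc x).box u s).2.val = labBlock u :=
    blockOfRow_box k c (labBlock_lt u).1 s
  rw [hrow]
  -- … and receives a letter of the content of `u`, i.e. of block `labBlock u`
  have hmem : (gadgetTab k c hk hc x).content π u
      (x (π ((gadgetTab k c hk hc x).box u s).1 ((gadgetTab k c hk hc x).box u s).2).val) ≠ 0 := by
    rw [TabM.content, wordContent_apply]
    apply Finset.card_ne_zero_of_mem (a := s)
    simp only [Finset.mem_filter, Finset.mem_univ, true_and]
    rfl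
  rw [hV u] at hmem
  obtain ⟨κ, hκ⟩ := exists_kind_of_gadgetExp_ne_zero k _ hmem
  have hlt : (π ((gadgetTab k c hk hc x).box u s).1 ((gadgetTab k c hk hc x).box u s).2).val < N :=
    lt_of_lt_of_le (Fin.isLt _) ((colHeight_le k c _).trans hN)
  have heq := hx.inj hlt (by unfold letterRow; have := (labBlock_lt u).1; omega) hκ
  rw [heq, blockOfRow_letterRow (labBlock_lt u).1]

end

end Summit.ValiantsHypothesis.ValiantsHypothesis.Theorems.GeneratorObstructions.PowGenDegreeQP
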